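import Literature.Geometry.Riemannian.MetricAssembly
import Literature.Geometry.Riemannian.RicciDeTurckChartNormSq
import Literature.Geometry.Riemannian.RicciFlowProofs
import Mathlib.Analysis.LocallyConvex.SeparatingDual
import HarnessLib

/-!
# The Ricci–DeTurck flow as a quasilinear system for vector-valued maps: the operators
(topic `Geometry/Riemannian`)

Second layer (after `MetricAssembly.lean`) of the reduction of short-time existence of the
Ricci–DeTurck flow on a closed manifold (hypothesis `hRE` of
`ricciFlow_shortTime_existence_of_ricciDeTurck`, `RicciFlowExistenceReduction.lean`; Topping
2006, §5.2, Step 1; DeTurck 1983; Hamilton 1982, Thm. 4.2) to the short-time existence theorem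
for quasilinear strictly parabolic second-order systems for PLAIN vector-valued maps
`u : M → W` on a closed manifold (Taylor, *PDE III*, Ch. 15, §8; Mantegazza–Martinazzi 2012,
Thm. 1.1). With the finite chart cover `𝒞` (functions `ρₖ`, `∑ ρₖ² = 1`, centres `cₖ`), the
embedding `ℰ` and the assembling map `𝒜` of `MetricAssembly.lean` (`𝒜 ∘ ℰ = sym`), this file
defines, for maps `U : M → W`, `W = Fin N → (E →L E →L ℝ)`:

* `ChartCover.lap z U x` — the chart Laplacian `gᵖ𐞥 ∂ₚ∂_q (U ∘ φ_z⁻¹)` at `φ_z x` with the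
  inverse metric of the assembled form `𝒜 U` read in the chart at `z`;
* `ChartCover.D0 U = ∑ₖ ρₖ² · lap cₖ U` (`𝒟₀`) — a globally defined second-order operator on
  vector-valued maps with scalar principal symbol `|ξ|²_{𝒜U}`;
* `rdtForm g h x` — the right-hand side `-2 Ric(g) + ℒ_{W(g,h)} g` of the Ricci–DeTurck equation
  (`RicciDeTurckFlow.lean`) as a family of continuous bilinear forms;
* `ChartCover.posSet`, `ChartCover.Adm`, `ChartCover.metricOf` — zeroth-order admissibility
  (`𝒜 U` positive definite), open, and the assembled Riemannian metric of an admissible `U`;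
* `ChartCover.P h U = 𝒟₀ U + ℰ(rdtForm (𝒜U) h) - ℰ(𝒜(𝒟₀ U))` (`𝒫`) — the vector-valued system.

and PROVES the identities that make `𝒫` quasilinear with scalar principal symbol (assembled in
`RicciDeTurckSystemStructure.lean`):

* `ChartCover.lap_center_eq` — **transformation of the chart Laplacian under change of chart**:
  `lap cₖ U x = lap z U x + D(U ∘ φ_z⁻¹)(φ_z x)[c]` with an explicit vector `c` built from the
  second derivative of the transition map and the inverse metrics (chain rule for second
  derivatives, `fderiv_fderiv_comp_apply`, and invariance of the metric trace under change of
  basis, `sum_gramInv_pullCLM_eq`);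
* `rdtForm_trivSymmL_eq_chartRHS` — `rdtForm` read in the chart at `z` is the explicit
  coordinate right-hand side `chartRHS` of `RicciDeTurckChartNormSq.lean` (diffeomorphism
  invariance `rdt_rhs_comap` + the coordinate formula `rdt_rhs_eq_coord`, exactly as in
  `IsRicciDeTurckFlow.hasDerivWithinAt_chartRep`);
* `fderiv_clmFamily_apply`, `fderiv_fderiv_clmFamily_apply` — product rules for
  `y ↦ 𝔞(y)[û(y)]`, the chart components of `𝒜 U` (`chartRep_eq_coeffCLM`).

Everything is proved; no named fact and no `sorry` is introduced.

## References

* P. Topping, *Lectures on the Ricci flow*, LMS LNS 325 (2006), §5.2, Step 1. [Topping2006]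
* D. M. DeTurck, Deforming metrics in the direction of their Ricci tensors, J. Differential
  Geom. 18 (1983) 157–162. [DeTurck1983]
* B. Andrews, C. Hopper, *The Ricci flow in Riemannian geometry*, LNM 2011 (2011), §5.4.1.
  [AndrewsHopper2011]
* M. E. Taylor, *Partial differential equations III. Nonlinear equations*, 2nd ed., Applied
  Math. Sciences 117, Springer 2011, Ch. 15, §8. [TaylorPDEIII2011]
-/

noncomputable section

set_option maxSynthPendingDepth 3

open Bundle Set Function Filter ContinuousLinearMap TopologicalSpace
open scoped Manifold ContDiff Topology Matrix

namespace Literature.Geometry.Riemannian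

open Lorentzian Lorentzian.OpensChart Lorentzian.PseudoRiemannianMetric
open Literature.Geometry.Riemannian.OpensChart

/-! ### Linear algebra: bilinear forms at the model type -/

section LinAlg

variable {E : Type*} [NormedAddCommGroup E] [NormedSpace ℝ E] [FiniteDimensional ℝ E]
  {F : Type*} [NormedAddCommGroup F] [NormedSpace ℝ F]
  {ι : Type*} [Fintype ι] [DecidableEq ι]

/-- A bilinear form on a finite-dimensional space as a continuous bilinear form (all linear maps
are continuous in finite dimension). [folklore] -/
def toCLM₂ (B : E →ₗ[ℝ] E →ₗ[ℝ] ℝ) : E →L[ℝ] E →L[ℝ] ℝ :=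
  LinearMap.toContinuousLinearMap
    ((LinearMap.toContinuousLinearMap : (E →ₗ[ℝ] ℝ) ≃ₗ[ℝ] (E →L[ℝ] ℝ)).toLinearMap ∘ₗ B)

omit [DecidableEq ι] [Fintype ι] in
/-- `toCLM₂ B v w = B v w`. [folklore] -/
@[simp]
theorem toCLM₂_apply (B : E →ₗ[ℝ] E →ₗ[ℝ] ℝ) (v w : E) : toCLM₂ B v w = B v w := rfl

omit [FiniteDimensional ℝ E] [DecidableEq ι] [Fintype ι] in
/-- Two continuous bilinear maps agreeing on pairs of basis vectors are equal. [folklore] -/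
theorem clm₂_ext_basis (b : Module.Basis ι ℝ E) {B B' : E →L[ℝ] E →L[ℝ] F}
    (h : ∀ i j, B (b i) (b j) = B' (b i) (b j)) : B = B' := by
  have h1 : ∀ i, B (b i) = B' (b i) := fun i ↦ by
    refine ContinuousLinearMap.coe_injective (b.ext fun j ↦ ?_)
    exact h i j
  refine ContinuousLinearMap.coe_injective (b.ext fun i ↦ ?_)
  exact h1 i

omit [FiniteDimensional ℝ E] [DecidableEq ι] in
/-- **Invariance of the metric contraction under change of basis**, for vector-valued forms:
for an invertible `A`, `∑ᵢⱼ ((A b)-Gram of G)⁻¹ⱼᵢ · B(A bᵢ, A bⱼ) = ∑ᵢⱼ (b-Gram of G)⁻¹ⱼᵢ · B(bᵢ, bⱼ)`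
whenever the scalar identity holds for all functionals of `B` — the reduction of the
vector-valued statement to the scalar one (`SeparatingDual.eq_iff_forall_dual_eq`). [folklore] -/
theorem sum_smul_eq_of_forall_dual {W' : Type*} [NormedAddCommGroup W'] [NormedSpace ℝ W']
    {m m' : ι → ι → ℝ} {B B' : ι → ι → W'}
    (h : ∀ ℓ : StrongDual ℝ W', ∑ i, ∑ j, m i j * ℓ (B i j) = ∑ i, ∑ j, m' i j * ℓ (B' i j)) :
    ∑ i, ∑ j, m i j • B i j = ∑ i, ∑ j, m' i j • B' i j := by
  rw [SeparatingDual.eq_iff_forall_dual_eq (R := ℝ)]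
  intro ℓ
  simpa only [map_sum, map_smul, smul_eq_mul] using h ℓ

end LinAlg

/-! ### The chain rule for second derivatives -/

section ChainRule

variable {E : Type*} [NormedAddCommGroup E] [NormedSpace ℝ E]
  {E' : Type*} [NormedAddCommGroup E'] [NormedSpace ℝ E']
  {F : Type*} [NormedAddCommGroup F] [NormedSpace ℝ F]

/-- **Chain rule for second derivatives**: for `f` of class `C²` at `τ y` and `τ` of class `C²`
at `y`, `D²(f ∘ τ)(y)(v, v') = D²f(τ y)(Dτ v, Dτ v') + Df(τ y)(D²τ(y)(v, v'))` (in Mathlib's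
convention `fderiv (fderiv f) y v v' = ∂_v ∂_{v'} f`). [folklore] -/
theorem fderiv_fderiv_comp_apply {f : E' → F} {τ : E → E'} {y : E}
    (hf : ContDiffAt ℝ 2 f (τ y)) (hτ : ContDiffAt ℝ 2 τ y) (v v' : E) :
    fderiv ℝ (fderiv ℝ (f ∘ τ)) y v v' =
      fderiv ℝ (fderiv ℝ f) (τ y) (fderiv ℝ τ y v) (fderiv ℝ τ y v')
        + fderiv ℝ f (τ y) (fderiv ℝ (fderiv ℝ τ) y v v') := by
  have h2 : (2 : ℕ∞ω) ≠ 0 := two_ne_zero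
  have h2' : (2 : ℕ∞ω) ≠ ∞ := by decide
  have hτc : ContinuousAt τ y := hτ.continuousAt
  -- the set of points where the factorised formula for the first derivative holds
  have hev : ∀ᶠ y' in 𝓝 y, DifferentiableAt ℝ f (τ y') ∧ DifferentiableAt ℝ τ y' := by
    have h1 : ∀ᶠ y' in 𝓝 y, ContDiffAt ℝ 2 f (τ y') := hτc.eventually (hf.eventually h2')
    filter_upwards [h1, hτ.eventually h2'] with y' hy1 hy2
    exact ⟨hy1.differentiableAt h2, hy2.differentiableAt h2⟩
  have hD : fderiv ℝ (f ∘ τ) =ᶠ[𝓝 y] fun y' ↦ (fderiv ℝ f (τ y')).comp (fderiv ℝ τ y') := by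
    filter_upwards [hev] with y' hy'
    exact fderiv_comp y' hy'.1 hy'.2
  rw [hD.fderiv_eq]
  -- differentiability of the two factors at `y`
  have h11 : (1 : ℕ∞ω) + 1 ≤ 2 := le_of_eq (by norm_num)
  have hf1 : ContDiffAt ℝ 1 (fderiv ℝ f) (τ y) := hf.fderiv_right h11
  have hτ1 : ContDiffAt ℝ 1 (fderiv ℝ τ) y := hτ.fderiv_right h11
  have hc : DifferentiableAt ℝ (fun y' ↦ fderiv ℝ f (τ y')) y :=
    (hf1.differentiableAt one_ne_zero).comp y (hτ.differentiableAt h2)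
  have hd : DifferentiableAt ℝ (fun y' ↦ fderiv ℝ τ y') y := hτ1.differentiableAt one_ne_zero
  rw [fderiv_clm_comp hc hd]
  have hchain : fderiv ℝ (fun y' ↦ fderiv ℝ f (τ y')) y =
      (fderiv ℝ (fderiv ℝ f) (τ y)).comp (fderiv ℝ τ y) :=
    fderiv_comp y (hf1.differentiableAt one_ne_zero) (hτ.differentiableAt h2)
  rw [hchain]
  simp only [_root_.add_apply, ContinuousLinearMap.coe_comp, Function.comp_apply,
    ContinuousLinearMap.compL_apply, ContinuousLinearMap.flip_apply]
  rw [add_comm]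

end ChainRule

/-! ### Product rules for a smooth family of linear maps applied to a map -/

section ProductRule

variable {E : Type*} [NormedAddCommGroup E] [NormedSpace ℝ E]
  {W : Type*} [NormedAddCommGroup W] [NormedSpace ℝ W]
  {V : Type*} [NormedAddCommGroup V] [NormedSpace ℝ V]

/-- **First derivative of `y ↦ 𝔞(y)[û(y)]`**: `D(𝔞[û])(y) v = 𝔞(y)(Dû(y) v) + (D𝔞(y) v)(û y)`
(Mathlib's `fderiv_clm_apply`). [folklore] -/
theorem fderiv_clmFamily_apply {𝔞 : E → W →L[ℝ] V} {u : E → W} {y : E}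
    (h𝔞 : DifferentiableAt ℝ 𝔞 y) (hu : DifferentiableAt ℝ u y) (v : E) :
    fderiv ℝ (fun y ↦ 𝔞 y (u y)) y v = 𝔞 y (fderiv ℝ u y v) + fderiv ℝ 𝔞 y v (u y) := by
  rw [fderiv_clm_apply h𝔞 hu]
  rfl

/-- **Second derivative of `y ↦ 𝔞(y)[û(y)]`**:
`D²(𝔞[û])(y)(v, v') = 𝔞(y)(D²û(y)(v, v')) + (D𝔞(y) v)(Dû(y) v') + (D𝔞(y) v')(Dû(y) v)
  + (D²𝔞(y)(v, v'))(û y)` for `𝔞`, `û` of class `C²` at `y`. [folklore] -/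
theorem fderiv_fderiv_clmFamily_apply {𝔞 : E → W →L[ℝ] V} {u : E → W} {y : E}
    (h𝔞 : ContDiffAt ℝ 2 𝔞 y) (hu : ContDiffAt ℝ 2 u y) (v v' : E) :
    fderiv ℝ (fderiv ℝ (fun y ↦ 𝔞 y (u y))) y v v' =
      𝔞 y (fderiv ℝ (fderiv ℝ u) y v v') + fderiv ℝ 𝔞 y v (fderiv ℝ u y v')
        + fderiv ℝ 𝔞 y v' (fderiv ℝ u y v) + fderiv ℝ (fderiv ℝ 𝔞) y v v' (u y) := by
  -- on a neighbourhood of `y` both maps are differentiable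
  have h2 : (2 : ℕ∞ω) ≠ 0 := two_ne_zero
  have h2' : (2 : ℕ∞ω) ≠ ∞ := by decide
  have hev : ∀ᶠ y' in 𝓝 y, DifferentiableAt ℝ 𝔞 y' ∧ DifferentiableAt ℝ u y' := by
    filter_upwards [h𝔞.eventually h2', hu.eventually h2'] with y' h1 h3
    exact ⟨h1.differentiableAt h2, h3.differentiableAt h2⟩
  have hD : fderiv ℝ (fun y ↦ 𝔞 y (u y)) =ᶠ[𝓝 y]
      fun y' ↦ (𝔞 y').comp (fderiv ℝ u y') + (fderiv ℝ 𝔞 y').flip (u y') := by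
    filter_upwards [hev] with y' hy'
    exact fderiv_clm_apply hy'.1 hy'.2
  rw [hD.fderiv_eq]
  have h11 : (1 : ℕ∞ω) + 1 ≤ 2 := le_of_eq (by norm_num)
  have h𝔞1 : ContDiffAt ℝ 1 (fderiv ℝ 𝔞) y := h𝔞.fderiv_right h11
  have hu1 : ContDiffAt ℝ 1 (fderiv ℝ u) y := hu.fderiv_right h11
  have h𝔞d : DifferentiableAt ℝ 𝔞 y := h𝔞.differentiableAt h2
  have hud : DifferentiableAt ℝ u y := hu.differentiableAt h2
  have h𝔞1d : DifferentiableAt ℝ (fderiv ℝ 𝔞) y := h𝔞1.differentiableAt one_ne_zero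
  have hu1d : DifferentiableAt ℝ (fderiv ℝ u) y := hu1.differentiableAt one_ne_zero
  -- the map `y' ↦ (D𝔞 y').flip` is differentiable, with derivative `flip ∘ D²𝔞`
  set Fl : (E →L[ℝ] W →L[ℝ] V) →L[ℝ] (W →L[ℝ] E →L[ℝ] V) :=
    (ContinuousLinearMap.flipₗᵢ ℝ E W V).toContinuousLinearEquiv.toContinuousLinearMap with hFl
  have hFl_apply : ∀ T : E →L[ℝ] W →L[ℝ] V, Fl T = T.flip := fun T ↦ rfl
  have hflipd : DifferentiableAt ℝ (fun y' ↦ (fderiv ℝ 𝔞 y').flip) y := by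
    have h := (Fl.differentiableAt (x := fderiv ℝ 𝔞 y)).comp y h𝔞1d
    exact h
  have hflip_fderiv : fderiv ℝ (fun y' ↦ (fderiv ℝ 𝔞 y').flip) y =
      Fl.comp (fderiv ℝ (fderiv ℝ 𝔞) y) := by
    have h := fderiv_comp y (Fl.differentiableAt (x := fderiv ℝ 𝔞 y)) h𝔞1d
    rw [Fl.fderiv] at h
    exact h
  have hA : DifferentiableAt ℝ (fun y' ↦ (𝔞 y').comp (fderiv ℝ u y')) y := h𝔞d.clm_comp hu1d
  have hB : DifferentiableAt ℝ (fun y' ↦ (fderiv ℝ 𝔞 y').flip (u y')) y := hflipd.clm_apply hud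
  rw [fderiv_fun_add hA hB, fderiv_clm_comp h𝔞d hu1d, fderiv_clm_apply hflipd hud, hflip_fderiv]
  simp only [_root_.add_apply, ContinuousLinearMap.coe_comp, Function.comp_apply,
    ContinuousLinearMap.compL_apply, ContinuousLinearMap.flip_apply, hFl_apply]
  abel

end ProductRule

/-! ### Frames of the cover and Mathlib's tangent coordinate changes -/

section TangentCoord

variable {E : Type*} [NormedAddCommGroup E] [NormedSpace ℝ E] {H : Type*} [TopologicalSpace H]
  {I : ModelWithCorners ℝ E H} [I.Boundaryless] {M : Type*} [TopologicalSpace M]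
  [ChartedSpace H M] [IsManifold I ∞ M]

omit [I.Boundaryless] in
/-- **The frame composite is the tangent coordinate change**: on the common chart domain,
`e_z ∘ e_{z'}⁻¹ = tangentCoordChange I z' z` (both are the coordinate change of the tangent
bundle core between the preferred charts at `z'` and `z`; Mathlib's
`continuousLinearMapAt_trivializationAt_eq_core`, `symmL_trivializationAt_eq_core`,
`tangentCoordChange_comp`). [folklore] -/
theorem trivCLM_comp_trivSymmL_eq_tangentCoordChange {z z' x : M}
    (hz' : x ∈ (chartAt H z').source) (hz : x ∈ (chartAt H z).source) :
    (trivCLM I z x).comp (trivSymmL I z' x) = tangentCoordChange I z' z x := by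
  ext v
  rw [ContinuousLinearMap.coe_comp, Function.comp_apply, trivCLM, trivSymmL,
    TangentBundle.continuousLinearMapAt_trivializationAt_eq_core hz,
    TangentBundle.symmL_trivializationAt_eq_core hz']
  have hx : x ∈ (extChartAt I x).source := mem_extChartAt_source x
  have hz'' : x ∈ (extChartAt I z').source := by rwa [_root_.extChartAt_source I]
  have hzz : x ∈ (extChartAt I z).source := by rwa [_root_.extChartAt_source I]
  exact tangentCoordChange_comp (w := z') (x := x) (y := z) ⟨⟨hz'', hx⟩, hzz⟩

/-- **The tangent coordinate change is the derivative of the transition map** (boundaryless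
model, so `range I = univ`): `tangentCoordChange I z' z x = D(φ_z ∘ φ_{z'}⁻¹)(φ_{z'} x)`.
[folklore] -/
theorem tangentCoordChange_eq_fderiv {z z' x : M} (hz' : x ∈ (chartAt H z').source)
    (hz : x ∈ (chartAt H z).source) :
    tangentCoordChange I z' z x =
      fderiv ℝ (extChartAt I z ∘ (extChartAt I z').symm) (extChartAt I z' x) := by
  have hz'' : x ∈ (extChartAt I z').source := by rwa [_root_.extChartAt_source I]
  have hzz : x ∈ (extChartAt I z).source := by rwa [_root_.extChartAt_source I]
  have h := hasFDerivWithinAt_tangentCoordChange (I := I) (x := z') (y := z) (z := x) ⟨hz'', hzz⟩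
  rw [ModelWithCorners.Boundaryless.range_eq_univ, hasFDerivWithinAt_univ] at h
  exact h.fderiv.symm

/-- The transition map `φ_z ∘ φ_{z'}⁻¹` is `C^∞` at `φ_{z'} x` for `x` in both chart domains
(boundaryless model). [folklore] -/
theorem contDiffAt_transition {z z' x : M} (hz' : x ∈ (chartAt H z').source)
    (hz : x ∈ (chartAt H z).source) {n : ℕ∞ω} (hn : n ≤ ∞) :
    ContDiffAt ℝ n (extChartAt I z ∘ (extChartAt I z').symm) (extChartAt I z' x) := by
  have hz'' : x ∈ (extChartAt I z').source := by rwa [_root_.extChartAt_source I]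
  have hzz : x ∈ (extChartAt I z).source := by rwa [_root_.extChartAt_source I]
  have hy : extChartAt I z' x ∈ ((extChartAt I z').symm ≫ extChartAt I z).source := by
    rw [PartialEquiv.trans_source'', PartialEquiv.symm_symm, PartialEquiv.symm_target]
    exact mem_image_of_mem _ ⟨hz'', hzz⟩
  have h := (contDiffWithinAt_ext_coord_change (I := I) (n := ∞) z z' hy).of_le hn
  rw [ModelWithCorners.Boundaryless.range_eq_univ] at h
  exact h.contDiffAt univ_mem

omit [IsManifold I ∞ M] in
/-- **Local factorisation of chart expressions**: near `φ_{z'} x`,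
`U ∘ φ_{z'}⁻¹ = (U ∘ φ_z⁻¹) ∘ (φ_z ∘ φ_{z'}⁻¹)` for `x` in both chart domains. [folklore] -/
theorem comp_extChartAt_symm_eventuallyEq {W : Type*} (U : M → W) {z z' x : M}
    (hz' : x ∈ (chartAt H z').source) (hz : x ∈ (chartAt H z).source) :
    (U ∘ (extChartAt I z').symm) =ᶠ[𝓝 (extChartAt I z' x)]
      ((U ∘ (extChartAt I z).symm) ∘ (extChartAt I z ∘ (extChartAt I z').symm)) := by
  have hz'' : x ∈ (extChartAt I z').source := by rwa [_root_.extChartAt_source I]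
  have hzz : x ∈ (extChartAt I z).source := by rwa [_root_.extChartAt_source I]
  -- points of the target of `φ_{z'}` mapped into the domain of `φ_z`
  have h1 : ∀ᶠ y in 𝓝 (extChartAt I z' x), y ∈ (extChartAt I z').target :=
    (isOpen_extChartAt_target z').mem_nhds ((extChartAt I z').map_source hz'')
  have h2 : ∀ᶠ y in 𝓝 (extChartAt I z' x), (extChartAt I z').symm y ∈ (extChartAt I z).source := by
    have hc : ContinuousAt (extChartAt I z').symm (extChartAt I z' x) :=
      continuousAt_extChartAt_symm'' ((extChartAt I z').map_source hz'')
    refine hc.preimage_mem_nhds ?_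
    rw [(extChartAt I z').left_inv hz'']
    exact (isOpen_extChartAt_source z).mem_nhds hzz
  filter_upwards [h1, h2] with y hy1 hy2
  simp only [Function.comp_apply, (extChartAt I z).left_inv hy2]

end TangentCoord

namespace ChartCover

/-! ### The chart Laplacians and the operator `𝒟₀` -/

section Lap

variable {E : Type*} [NormedAddCommGroup E] [NormedSpace ℝ E] {H : Type*} [TopologicalSpace H]
  {I : ModelWithCorners ℝ E H} {M : Type*} [TopologicalSpace M] [ChartedSpace H M]
  [IsManifold I ∞ M] {N : ℕ} (𝒞 : ChartCover I M N)
  {ι : Type*} [Fintype ι] [DecidableEq ι] (b : Module.Basis ι ℝ E)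

/-- **The chart Laplacian at `z`** of a map `U : M → W`, `W = Fin N → (E →L E →L ℝ)`, at `x`:
`lap z U x = ∑ᵢⱼ gʲⁱ · ∂²_{bᵢ bⱼ}(U ∘ φ_z⁻¹)(φ_z x)`, where `(gʲⁱ) = gramInv b (G_z)` is the
inverse Gram matrix of the components `G_z = coeffCLM z x (U x)` of the assembled form `𝒜 U` in
the chart at `z` (`pullCLM_trivSymmL_assembleAt`). [folklore] -/
def lap (z : M) (U : M → Fin N → (E →L[ℝ] E →L[ℝ] ℝ)) (x : M) : Fin N → (E →L[ℝ] E →L[ℝ] ℝ) :=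
  ∑ i, ∑ j, gramInv b (𝒞.coeffCLM z x (U x)) j i •
    fderiv ℝ (fderiv ℝ (U ∘ (extChartAt I z).symm)) (extChartAt I z x) (b i) (b j)

/-- **The operator `𝒟₀`**: `𝒟₀ U = ∑ₖ ρₖ² · lap cₖ U`, the `ρₖ²`-weighted sum of the chart
Laplacians of the cover (`∑ₖ ρₖ² = 1`, so its principal symbol is `|ξ|²_{𝒜U}` times the
identity; `D0_eq_lap_add`). [folklore] -/
def D0 (U : M → Fin N → (E →L[ℝ] E →L[ℝ] ℝ)) (x : M) : Fin N → (E →L[ℝ] E →L[ℝ] ℝ) :=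
  ∑ k, (𝒞.ρ k x) ^ 2 • 𝒞.lap b (𝒞.center k) U x

/-- **The correction vector of the change of chart** from `cₖ` to `z` at `x`:
`cvec k z G x = ∑ᵢⱼ (A-Gram of G)⁻¹ⱼᵢ · D²(φ_z ∘ φ_{cₖ}⁻¹)(φ_{cₖ} x)(bᵢ, bⱼ)`, `A` the tangent
coordinate change from `cₖ` to `z` and `G` the components of the metric in the chart at `z`.
[folklore] -/
def cvec (k : Fin N) (z : M) (G : E →L[ℝ] E →L[ℝ] ℝ) (x : M) : E :=
  ∑ i, ∑ j, gramInv b (pullCLM (tangentCoordChange I (𝒞.center k) z x) G) j i •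
    fderiv ℝ (fderiv ℝ (extChartAt I z ∘ (extChartAt I (𝒞.center k)).symm))
      (extChartAt I (𝒞.center k) x) (b i) (b j)

variable [I.Boundaryless] [FiniteDimensional ℝ E]

omit [FiniteDimensional ℝ E] [I.Boundaryless] in
/-- The inverse frame of the centre `cₖ` factors through that of `z`: `σₖ = e_z⁻¹ ∘ A` with
`A = tangentCoordChange I cₖ z x` on the common chart domain. [folklore] -/
theorem σ_eq_trivSymmL_comp_tangentCoordChange {k : Fin N} {z x : M}
    (hk : x ∈ (chartAt H (𝒞.center k)).source) (hz : x ∈ (chartAt H z).source) :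
    𝒞.σ k x = (trivSymmL I z x).comp (tangentCoordChange I (𝒞.center k) z x) := by
  rw [← trivCLM_comp_trivSymmL_eq_tangentCoordChange hk hz, ← ContinuousLinearMap.comp_assoc]
  ext a
  rw [ContinuousLinearMap.coe_comp, Function.comp_apply]
  exact (trivSymmL_trivCLM hz _).symm

omit [FiniteDimensional ℝ E] [I.Boundaryless] in
/-- The components of the assembled form in the chart at the centre `cₖ` are those in the chart
at `z` pulled back along the tangent coordinate change:
`coeffCLM cₖ x w = pullCLM A (coeffCLM z x w)`. [folklore] -/
theorem coeffCLM_center_eq_pullCLM {k : Fin N} {z x : M}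
    (hk : x ∈ (chartAt H (𝒞.center k)).source) (hz : x ∈ (chartAt H z).source)
    (w : Fin N → (E →L[ℝ] E →L[ℝ] ℝ)) :
    𝒞.coeffCLM (𝒞.center k) x w =
      pullCLM (tangentCoordChange I (𝒞.center k) z x) (𝒞.coeffCLM z x w) := by
  rw [← pullCLM_trivSymmL_assembleAt, ← pullCLM_trivSymmL_assembleAt, ← pullCLM_comp,
    ← 𝒞.σ_eq_trivSymmL_comp_tangentCoordChange hk hz]

omit [I.Boundaryless] in
/-- **Invariance of the metric contraction under the change of frame**, vector-valued version:
for a metric `g` with `g_x = 𝒜_x w` and any `B : E →L E →L W'`,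
`∑ᵢⱼ (Gram_{cₖ})⁻¹ⱼᵢ · B(A bᵢ, A bⱼ) = ∑ᵢⱼ (Gram_z)⁻¹ⱼᵢ · B(bᵢ, bⱼ)`, `A` the tangent coordinate
change from `cₖ` to `z`: both sides are the metric trace `tr_{g_x}` of the form
`(X, Y) ↦ B(e_z X, e_z Y)` computed in the bases `σₖ b` and `σ_z b` of `T_x M`
(`trace_eq_sum_gram_inv`, `CurvatureRegularity.lean`), functional by functional.
[cite: ONeill1983, Ch. 3, pp. 60–61] -/
theorem sum_gramInv_pullCLM_eq {W' : Type*} [NormedAddCommGroup W'] [NormedSpace ℝ W']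
    (g : PseudoRiemannianMetric I ∞ E (TangentSpace I : M → Type _))
    {w : Fin N → (E →L[ℝ] E →L[ℝ] ℝ)} {x : M} (hg : g.val x = 𝒞.assembleAt w x)
    {k : Fin N} {z : M} (hk : x ∈ (chartAt H (𝒞.center k)).source)
    (hz : x ∈ (chartAt H z).source) (B : E →L[ℝ] E →L[ℝ] W') :
    ∑ i, ∑ j, gramInv b (𝒞.coeffCLM (𝒞.center k) x w) j i •
        B (tangentCoordChange I (𝒞.center k) z x (b i))
          (tangentCoordChange I (𝒞.center k) z x (b j)) =
      ∑ i, ∑ j, gramInv b (𝒞.coeffCLM z x w) j i • B (b i) (b j) := by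
  classical
  haveI : FiniteDimensional ℝ (TangentSpace I x) := inferInstanceAs (FiniteDimensional ℝ E)
  refine sum_smul_eq_of_forall_dual fun ℓ ↦ ?_
  -- the scalar bilinear form `(X, Y) ↦ ℓ (B (e_z X) (e_z Y))`, at the model type and on `T_x M`
  set Bℓ : E →L[ℝ] E →L[ℝ] ℝ := ((ℓ : W' →L[ℝ] ℝ).postcomp E).comp B with hBℓ
  have hBℓ_apply : ∀ a a', Bℓ a a' = ℓ (B a a') := fun a a' ↦ rfl
  set T : LinearMap.BilinForm ℝ (TangentSpace I x) :=
    (ContinuousLinearMap.coeLM ℝ).comp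
      (Bℓ.bilinearComp (trivCLM I z x) (trivCLM I z x)).toLinearMap with hT
  have hT_apply : ∀ X Y : E, T X Y = ℓ (B (trivCLM I z x X) (trivCLM I z x Y)) := fun X Y ↦ rfl
  -- the inverse frames as `E`-valued linear equivalences, and the two bases of `T_x M`
  set ek : E ≃L[ℝ] E := ContinuousLinearEquiv.equivOfInverse (𝒞.σ k x) (𝒞.τ k x)
    (fun a ↦ 𝒞.τ_σ hk a) (fun v ↦ 𝒞.σ_τ hk v) with hek
  set ez : E ≃L[ℝ] E := ContinuousLinearEquiv.equivOfInverse (trivSymmL I z x) (trivCLM I z x)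
    (fun a ↦ trivCLM_trivSymmL hz a) (fun v ↦ trivSymmL_trivCLM hz v) with hez
  have hek_apply : ∀ a : E, ek a = 𝒞.σ k x a := fun a ↦ rfl
  have hez_apply : ∀ a : E, ez a = trivSymmL I z x a := fun a ↦ rfl
  set βk : Module.Basis ι ℝ (TangentSpace I x) := b.map ek.toLinearEquiv with hβk
  set βz : Module.Basis ι ℝ (TangentSpace I x) := b.map ez.toLinearEquiv with hβz
  have hβk_apply : ∀ i, (βk i : E) = 𝒞.σ k x (b i) := fun i ↦ rfl
  have hβz_apply : ∀ i, (βz i : E) = trivSymmL I z x (b i) := fun i ↦ rfl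
  have h1 := trace_eq_sum_gram_inv g x βk T
  have h2 := trace_eq_sum_gram_inv g x βz T
  -- Gram matrices: the components in the two charts
  have hval : ∀ (z' : M) (a a' : E), 𝒞.assembleAt w x (trivSymmL I z' x a) (trivSymmL I z' x a') =
      𝒞.coeffCLM z' x w a a' := fun z' a a' ↦ by
    rw [← pullCLM_trivSymmL_assembleAt, pullCLM_apply]
    rfl
  have hGk : (Matrix.of fun i j ↦ g.val x (βk i) (βk j)) =
      Matrix.of fun i j ↦ 𝒞.coeffCLM (𝒞.center k) x w (b i) (b j) := by
    ext i j
    rw [Matrix.of_apply, Matrix.of_apply, hg]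
    exact hval (𝒞.center k) (b i) (b j)
  have hGz : (Matrix.of fun i j ↦ g.val x (βz i) (βz j)) =
      Matrix.of fun i j ↦ 𝒞.coeffCLM z x w (b i) (b j) := by
    ext i j
    rw [Matrix.of_apply, Matrix.of_apply, hg]
    exact hval z (b i) (b j)
  -- values of `T` on the two bases
  have hTk : ∀ i j, T (βk i) (βk j) = ℓ (B (tangentCoordChange I (𝒞.center k) z x (b i))
      (tangentCoordChange I (𝒞.center k) z x (b j))) := by
    intro i j
    rw [← trivCLM_comp_trivSymmL_eq_tangentCoordChange hk hz]
    exact hT_apply _ _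
  have hTz : ∀ i j, T (βz i) (βz j) = ℓ (B (b i) (b j)) := by
    intro i j
    have h := hT_apply (trivSymmL I z x (b i)) (trivSymmL I z x (b j))
    rw [trivCLM_trivSymmL hz, trivCLM_trivSymmL hz] at h
    exact h
  rw [hGk] at h1
  rw [hGz] at h2
  simp only [hTk] at h1
  simp only [hTz] at h2
  change ∑ i, ∑ j, (Matrix.of fun i j ↦ 𝒞.coeffCLM (𝒞.center k) x w (b i) (b j))⁻¹ j i * _ =
    ∑ i, ∑ j, (Matrix.of fun i j ↦ 𝒞.coeffCLM z x w (b i) (b j))⁻¹ j i * _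
  rw [← h1, ← h2]

omit [IsManifold I ∞ M] [FiniteDimensional ℝ E] in
/-- A `C²` map read in a chart is `C²` at the image point (boundaryless model). [folklore] -/
theorem contDiffAt_comp_extChartAt_symm {W : Type*} [NormedAddCommGroup W] [NormedSpace ℝ W]
    {U : M → W} {x z : M} {n : ℕ∞ω} [IsManifold I n M] (hU : ContMDiffAt I 𝓘(ℝ, W) n U x)
    (hz : x ∈ (chartAt H z).source) :
    ContDiffAt ℝ n (U ∘ (extChartAt I z).symm) (extChartAt I z x) := by
  have hzz : x ∈ (extChartAt I z).source := by rwa [_root_.extChartAt_source I]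
  have h1 : ContMDiffWithinAt 𝓘(ℝ, E) I n (extChartAt I z).symm (range I) (extChartAt I z x) :=
    contMDiffWithinAt_extChartAt_symm_range (I := I) z ((extChartAt I z).map_source hzz)
  rw [ModelWithCorners.Boundaryless.range_eq_univ] at h1
  have h2 : ContMDiffAt I 𝓘(ℝ, W) n U ((extChartAt I z).symm (extChartAt I z x)) := by
    rwa [(extChartAt I z).left_inv hzz]
  have h := h2.comp_contMDiffWithinAt _ h1
  exact contMDiffAt_iff_contDiffAt.1 (h.contMDiffAt univ_mem)

/-- **Transformation of the chart Laplacian under change of chart.** For a metric `g` with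
`g_x = 𝒜_x (U x)`, a point `x` in the chart domains of the centre `cₖ` and of `z`, and `U` of
class `C²` at `x`:
`lap cₖ U x = lap z U x + D(U ∘ φ_z⁻¹)(φ_z x)[cvec k z G_z x]`.
Proof: near `φ_{cₖ} x` one has `U ∘ φ_{cₖ}⁻¹ = (U ∘ φ_z⁻¹) ∘ τ`, `τ = φ_z ∘ φ_{cₖ}⁻¹`
(`comp_extChartAt_symm_eventuallyEq`); by the chain rule for second derivatives
(`fderiv_fderiv_comp_apply`) `D²(U ∘ φ_{cₖ}⁻¹)(bᵢ, bⱼ) = D²(U ∘ φ_z⁻¹)(A bᵢ, A bⱼ) + D(U ∘ φ_z⁻¹)(D²τ(bᵢ, bⱼ))`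
with `A = Dτ = tangentCoordChange I cₖ z x` (`tangentCoordChange_eq_fderiv`), and the first sum is
contracted back to the basis `b` by `sum_gramInv_pullCLM_eq` (the components in the chart at
`cₖ` being `pullCLM A G_z`, `coeffCLM_center_eq_pullCLM`). This is the classical second-order
transformation law of `gᵖ𐞥∂ₚ∂_q` (a scalar operator up to first-order terms). [folklore] -/
theorem lap_center_eq (g : PseudoRiemannianMetric I ∞ E (TangentSpace I : M → Type _))
    {U : M → Fin N → (E →L[ℝ] E →L[ℝ] ℝ)} {x : M} (hg : g.val x = 𝒞.assembleAt (U x) x)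
    {k : Fin N} {z : M} (hk : x ∈ (chartAt H (𝒞.center k)).source)
    (hz : x ∈ (chartAt H z).source) (hU : ContMDiffAt I 𝓘(ℝ, Fin N → (E →L[ℝ] E →L[ℝ] ℝ)) 2 U x) :
    𝒞.lap b (𝒞.center k) U x = 𝒞.lap b z U x +
      fderiv ℝ (U ∘ (extChartAt I z).symm) (extChartAt I z x)
        (𝒞.cvec b k z (𝒞.coeffCLM z x (U x)) x) := by
  set τ := extChartAt I z ∘ (extChartAt I (𝒞.center k)).symm with hτ
  set uz := U ∘ (extChartAt I z).symm with huz
  have hkk : x ∈ (extChartAt I (𝒞.center k)).source := by rwa [_root_.extChartAt_source I]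
  have hτx : τ (extChartAt I (𝒞.center k) x) = extChartAt I z x := by
    simp only [hτ, Function.comp_apply, (extChartAt I (𝒞.center k)).left_inv hkk]
  -- second derivatives of the two chart expressions
  have hloc := comp_extChartAt_symm_eventuallyEq (I := I) U hk hz
  have hD2 : fderiv ℝ (fderiv ℝ (U ∘ (extChartAt I (𝒞.center k)).symm))
      (extChartAt I (𝒞.center k) x) =
      fderiv ℝ (fderiv ℝ (uz ∘ τ)) (extChartAt I (𝒞.center k) x) :=
    hloc.fderiv.fderiv_eq
  have huz2 : ContDiffAt ℝ 2 uz (τ (extChartAt I (𝒞.center k) x)) := by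
    rw [hτx]
    exact contDiffAt_comp_extChartAt_symm hU hz
  have hτ2 : ContDiffAt ℝ 2 τ (extChartAt I (𝒞.center k) x) :=
    contDiffAt_transition hk hz (WithTop.coe_le_coe.mpr le_top)
  have hA : fderiv ℝ τ (extChartAt I (𝒞.center k) x) = tangentCoordChange I (𝒞.center k) z x :=
    (tangentCoordChange_eq_fderiv hk hz).symm
  have hchain : ∀ i j, fderiv ℝ (fderiv ℝ (U ∘ (extChartAt I (𝒞.center k)).symm))
      (extChartAt I (𝒞.center k) x) (b i) (b j) =
      fderiv ℝ (fderiv ℝ uz) (extChartAt I z x) (tangentCoordChange I (𝒞.center k) z x (b i))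
        (tangentCoordChange I (𝒞.center k) z x (b j)) +
      fderiv ℝ uz (extChartAt I z x) (fderiv ℝ (fderiv ℝ τ) (extChartAt I (𝒞.center k) x)
        (b i) (b j)) := by
    intro i j
    rw [hD2, fderiv_fderiv_comp_apply huz2 hτ2, hA, hτx]
  -- assemble
  simp only [lap, hchain, smul_add, Finset.sum_add_distrib]
  congr 1
  · -- the principal part: contraction back to the basis `b`
    rw [𝒞.coeffCLM_center_eq_pullCLM hk hz (U x)]
    have h := 𝒞.sum_gramInv_pullCLM_eq b g hg hk hz (fderiv ℝ (fderiv ℝ uz) (extChartAt I z x))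
    rw [𝒞.coeffCLM_center_eq_pullCLM hk hz (U x)] at h
    exact h
  · -- the first-order part
    rw [cvec, map_sum]
    refine Finset.sum_congr rfl fun i _ ↦ ?_
    rw [map_sum]
    refine Finset.sum_congr rfl fun j _ ↦ ?_
    rw [map_smul, 𝒞.coeffCLM_center_eq_pullCLM hk hz (U x)]

/-- **`𝒟₀` in the chart at `z`**: at a point `x` of the chart domain of `z`, for `U` of class
`C²` at `x` with `g_x = 𝒜_x (U x)` for a metric `g`,
`𝒟₀ U x = lap z U x + D(U ∘ φ_z⁻¹)(φ_z x)[∑ₖ ρₖ(x)² cvec k z G_z x]` (`lap_center_eq` for the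
`k` with `ρₖ(x) ≠ 0`, which forces `x` into the chart domain of `cₖ`, and `∑ ρₖ² = 1`).
[folklore] -/
theorem D0_eq_lap_add (g : PseudoRiemannianMetric I ∞ E (TangentSpace I : M → Type _))
    {U : M → Fin N → (E →L[ℝ] E →L[ℝ] ℝ)} {x : M} (hg : g.val x = 𝒞.assembleAt (U x) x)
    {z : M} (hz : x ∈ (chartAt H z).source)
    (hU : ContMDiffAt I 𝓘(ℝ, Fin N → (E →L[ℝ] E →L[ℝ] ℝ)) 2 U x) :
    𝒞.D0 b U x = 𝒞.lap b z U x +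
      fderiv ℝ (U ∘ (extChartAt I z).symm) (extChartAt I z x)
        (∑ k, (𝒞.ρ k x) ^ 2 • 𝒞.cvec b k z (𝒞.coeffCLM z x (U x)) x) := by
  have hterm : ∀ k, (𝒞.ρ k x) ^ 2 • 𝒞.lap b (𝒞.center k) U x =
      (𝒞.ρ k x) ^ 2 • 𝒞.lap b z U x + fderiv ℝ (U ∘ (extChartAt I z).symm) (extChartAt I z x)
        ((𝒞.ρ k x) ^ 2 • 𝒞.cvec b k z (𝒞.coeffCLM z x (U x)) x) := by
    intro k
    by_cases h0 : 𝒞.ρ k x = 0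
    · simp [h0]
    · rw [𝒞.lap_center_eq b g hg (𝒞.mem_source_of_ne_zero h0) hz hU, smul_add, map_smul]
  simp only [D0, hterm, Finset.sum_add_distrib, ← Finset.sum_smul, 𝒞.sum_sq_eq_one x, one_smul,
    map_sum]

end Lap

end ChartCover

/-! ### The Ricci–DeTurck right-hand side as a family of bilinear forms -/

section RDTForm

variable {E : Type*} [NormedAddCommGroup E] [NormedSpace ℝ E] {H : Type*} [TopologicalSpace H]
  {I : ModelWithCorners ℝ E H} {M : Type*} [TopologicalSpace M] [ChartedSpace H M]
  [IsManifold I ∞ M] [FiniteDimensional ℝ E] [CompleteSpace E]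
  (g h : PseudoRiemannianMetric I ∞ E (TangentSpace I : M → Type _))
  [g.HasLeviCivita] [h.HasLeviCivita]

/-- The Lie-derivative term `ℒ_W g` of the Ricci–DeTurck equation, `W` the DeTurck field of
`(g, h)` (through the Levi-Civita connections), as a bilinear form on `T_x M` (`lieDerivMetric`
is bilinear: `∇W` is linear and `g` is bilinear). [cite: AndrewsHopper2011, §5.4.2, (5.10)] -/
def lieDerivBilin (x : M) : LinearMap.BilinForm ℝ (TangentSpace I x) :=
  LinearMap.mk₂ ℝ
    (fun X Y ↦ lieDerivMetric g g.leviCivita (deTurckField g g.leviCivita h.leviCivita) x X Y)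
    (fun X X' Y ↦ by simp only [lieDerivMetric, map_add, _root_.add_apply]; ring)
    (fun c X Y ↦ by simp only [lieDerivMetric, map_smul, _root_.smul_apply, smul_eq_mul]; ring)
    (fun X Y Y' ↦ by simp only [lieDerivMetric, map_add]; ring)
    (fun c X Y ↦ by simp only [lieDerivMetric, map_smul, smul_eq_mul]; ring)

omit [CompleteSpace E] in
/-- Unfolding lemma for `lieDerivBilin`. [folklore] -/
theorem lieDerivBilin_apply (x : M) (X Y : TangentSpace I x) :
    lieDerivBilin g h x X Y =
      lieDerivMetric g g.leviCivita (deTurckField g g.leviCivita h.leviCivita) x X Y := rfl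

/-- The right-hand side of the Ricci–DeTurck equation as a bilinear form on `T_x M`:
`-2 Ric_g + ℒ_W g`. [cite: AndrewsHopper2011, §5.4.2, (5.10)] -/
def rdtBilin (x : M) : LinearMap.BilinForm ℝ (TangentSpace I x) :=
  (-2 : ℝ) • g.ricci x + lieDerivBilin g h x

/-- **The right-hand side of the Ricci–DeTurck equation as a family of continuous bilinear forms**:
`rdtForm g h x (X, Y) = -2 Ric_g(X, Y) + (ℒ_W g)(X, Y)`, `W` the DeTurck field of `g` relative
to the Levi-Civita connection of the background `h` (`IsRicciDeTurckFlow.hasDerivWithinAt`,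
`RicciDeTurckFlow.lean`; Andrews–Hopper 2011, (5.10); Topping 2006, (5.2.2)). The Levi-Civita
connections enter through the (propositional) instances `[g.HasLeviCivita]`, `[h.HasLeviCivita]`,
available as `g.hasLeviCivita`. [cite: AndrewsHopper2011, §5.4.2, (5.10)] -/
def rdtForm (x : M) : TangentSpace I x →L[ℝ] TangentSpace I x →L[ℝ] ℝ :=
  toCLM₂ (E := E) (rdtBilin g h x)

omit [CompleteSpace E] in
/-- `rdtForm g h x (X, Y) = -2 Ric(X, Y) + ℒ_W g (X, Y)`. [folklore] -/
theorem rdtForm_apply (x : M) (X Y : TangentSpace I x) :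
    rdtForm g h x X Y = -2 * g.ricci x X Y +
      lieDerivMetric g g.leviCivita (deTurckField g g.leviCivita h.leviCivita) x X Y := by
  change ((-2 : ℝ) • g.ricci x + lieDerivBilin g h x) X Y = _
  rw [LinearMap.add_apply, LinearMap.smul_apply, LinearMap.add_apply, LinearMap.smul_apply,
    smul_eq_mul]
  rfl

/-- **`rdtForm` is symmetric** (the Ricci tensor of a `C^∞` metric is symmetric,
`ricci_symm_holds`; the Lie-derivative term is symmetric by construction). [folklore] -/
theorem rdtForm_symm (x : M) (X Y : TangentSpace I x) : rdtForm g h x X Y = rdtForm g h x Y X := by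
  rw [rdtForm_apply, rdtForm_apply]
  have hric : g.ricci x X Y = g.ricci x Y X :=
    (ricci_symm_holds (g := g) (WithTop.coe_le_coe.mpr le_top) x).eq X Y
  rw [hric, lieDerivMetric, lieDerivMetric, g.symm x (g.leviCivita _ x Y) X,
    g.symm x Y (g.leviCivita _ x X), add_comm (g.val x X _)]

variable [I.Boundaryless] {ι : Type*} [Fintype ι] [DecidableEq ι] (b : Module.Basis ι ℝ E)

/-- **`rdtForm` read in a chart is the explicit coordinate right-hand side.** For `y` in the
target of the chart at `z` and `x = φ_z⁻¹ y`:
`rdtForm g h x (e_z⁻¹ X₀, e_z⁻¹ Y₀) = chartRHS I b g h z y (X₀, Y₀)`, the coordinate expression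
`∑ gʲⁱ D²G(y)(bᵢ, bⱼ)(X₀, Y₀) + rdtLower b (G y) g⁻¹ (DG y) Γ̃ DΓ̃ (X₀, Y₀)` of
`RicciDeTurckChartNormSq.lean` built on the representative `G = chartRep I g z` — diffeomorphism
invariance of the Ricci–DeTurck operator under the inverse chart (`rdt_rhs_comap`,
`mfderiv_chartInv_eq_symmL`) followed by the coordinate formula `rdt_rhs_eq_coord`
(`RicciDeTurckCoord.lean`), exactly as in `IsRicciDeTurckFlow.hasDerivWithinAt_chartRep`.
[cite: AndrewsHopper2011, §5.4.1, (5.6)–(5.9)] [cite: Topping2006, §5.2, Step 1] -/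
theorem rdtForm_trivSymmL_eq_chartRHS (z : M) {y : E} (hy : y ∈ (extChartAt I z).target)
    (X₀ Y₀ : E) :
    rdtForm g h ((extChartAt I z).symm y) (trivSymmL I z ((extChartAt I z).symm y) X₀)
        (trivSymmL I z ((extChartAt I z).symm y) Y₀) =
      chartRHS I b (fun _ ↦ g) h z 0 y X₀ Y₀ := by
  haveI := (chartPullback I g z).hasLeviCivita
  haveI := (chartPullback I h z).hasLeviCivita
  set u : chartTarget I z := ⟨y, hy⟩ with hu
  have hW := mdifferentiableAt_deTurckField_univ g h (chartInv I z u)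
  have hnat := rdt_rhs_comap g h contMDiff_pullbackBilin_holds (contMDiff_chartInv z)
    (injective_mfderiv_chartInv z) rfl hW X₀ Y₀
  have hfr : ∀ V : E, (mfderiv 𝓘(ℝ, E) I (chartInv I z) u V : TangentSpace I (chartInv I z u)) =
      trivSymmL I z ((extChartAt I z).symm y) V := fun V ↦ mfderiv_chartInv_eq_symmL z u V
  rw [hfr X₀, hfr Y₀] at hnat
  rw [rdtForm_apply]
  change -2 * g.ricci (chartInv I z u) _ _ +
    lieDerivMetric g g.leviCivita (deTurckField g g.leviCivita h.leviCivita) (chartInv I z u) _ _ = _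
  rw [← hnat]
  -- the coordinate formula on the chart target
  have hG : ∀ y' : chartTarget I z, (chartPullback I g z).val y' = chartRep I (fun _ ↦ g) z 0 y' :=
    val_chartPullback_eq_chartRep (fun _ ↦ g) z 0
  have hCb : ∀ (y' : chartTarget I z) (Y₁ X₁ : E),
      ((chartPullback I h z).leviCivita (fun _ : chartTarget I z ↦ (Y₁ : E)) y' X₁ : E) =
        (fun y'' Y₁ X₁ ↦ bgChris I b h z y'' Y₁ X₁) y' Y₁ X₁ := fun y' Y₁ X₁ ↦
    leviCivita_chartPullback_const_apply b h z y' Y₁ X₁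
  have hCd : ∀ i j, DifferentiableAt ℝ (fun y'' : E ↦
      (fun y'' Y₁ X₁ ↦ bgChris I b h z y'' Y₁ X₁) y'' (b i) (b j)) u := fun i j ↦
    differentiableAt_chris_chartRep b h z u (b i) (b j)
  have hcoord := rdt_rhs_eq_coord hG b _ hCb u hCd X₀ Y₀
  dsimp only [chartPullback] at hcoord ⊢
  rw [hcoord]
  rfl

end RDTForm

namespace ChartCover

/-! ### Admissibility, the assembled metric and the operator `𝒫` -/

section Operator

variable {E : Type*} [NormedAddCommGroup E] [NormedSpace ℝ E] {H : Type*} [TopologicalSpace H]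
  {I : ModelWithCorners ℝ E H} {M : Type*} [TopologicalSpace M] [ChartedSpace H M]
  [IsManifold I ∞ M] {N : ℕ} (𝒞 : ChartCover I M N)

/-- **The admissible set** `𝒪 = {(x, w) | 𝒜_x w positive definite}` ⊆ `M × W`: the zeroth-order
condition under which the assembled form of a value `w` at `x` is a Riemannian metric at `x`.
[folklore] -/
def posSet : Set (M × (Fin N → (E →L[ℝ] E →L[ℝ] ℝ))) :=
  {p | ∀ v : E, v ≠ 0 → 0 < 𝒞.assembleAt p.2 p.1 v v}

/-- Positive definiteness of the assembled form is positive definiteness of its components in a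
chart. [folklore] -/
theorem mem_posSet_iff_coeffCLM {z x : M} (hx : x ∈ (chartAt H z).source)
    (w : Fin N → (E →L[ℝ] E →L[ℝ] ℝ)) :
    (x, w) ∈ 𝒞.posSet ↔ ∀ a : E, a ≠ 0 → 0 < 𝒞.coeffCLM z x w a a := by
  constructor
  · intro hp a ha
    rw [← pullCLM_trivSymmL_assembleAt, pullCLM_apply]
    refine hp _ fun h0 ↦ ha ?_
    have := congrArg (trivCLM I z x) h0
    rwa [trivCLM_trivSymmL hx, map_zero] at this
  · intro hp v hv
    have h := hp (trivCLM I z x v) fun h0 ↦ hv ?_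
    · rw [← pullCLM_trivSymmL_assembleAt, pullCLM_apply, trivSymmL_trivCLM hx] at h
      exact h
    · have := congrArg (trivSymmL I z x) h0
      rwa [trivSymmL_trivCLM hx, map_zero] at this

variable [FiniteDimensional ℝ E]

omit [IsManifold I ∞ M] in
/-- Positive definite forms form an open subset of `E →L E →L ℝ` (finite dimension;
`exists_pos_mul_norm_sq_le_of_forall_pos` and `forall_pos_of_norm_sub_lt`, `RicciFlowProofs.lean`).
[folklore] -/
theorem isOpen_setOf_posDef :
    IsOpen {B : E →L[ℝ] E →L[ℝ] ℝ | ∀ v : E, v ≠ 0 → 0 < B v v} := by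
  rw [Metric.isOpen_iff]
  intro B hB
  obtain ⟨m, hm, hmB⟩ := exists_pos_mul_norm_sq_le_of_forall_pos B hB
  refine ⟨m, hm, fun B' hB' v hv ↦ ?_⟩
  exact forall_pos_of_norm_sub_lt hmB (by rwa [← dist_eq_norm]) v hv

/-- **The admissible set is open** (in a chart it is the preimage of the open set of positive
definite forms under the jointly continuous component map `(x, w) ↦ coeffCLM z x w`).
[folklore] -/
theorem isOpen_posSet : IsOpen 𝒞.posSet := by
  rw [isOpen_iff_mem_nhds]
  rintro ⟨x₀, w₀⟩ hp
  have hx₀ : x₀ ∈ (chartAt H x₀).source := mem_chart_source H x₀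
  -- the component map in the chart at `x₀` is continuous on `source × univ`
  have hF : ContinuousOn (fun p : M × (Fin N → (E →L[ℝ] E →L[ℝ] ℝ)) ↦ 𝒞.coeffCLM x₀ p.1 p.2)
      ((chartAt H x₀).source ×ˢ univ) := by
    have h1 : ContinuousOn (fun p : M × (Fin N → (E →L[ℝ] E →L[ℝ] ℝ)) ↦ 𝒞.coeffCLM x₀ p.1)
        ((chartAt H x₀).source ×ˢ univ) :=
      (𝒞.contMDiffOn_coeffCLM x₀).continuousOn.comp continuousOn_fst fun p hp ↦ hp.1
    exact h1.clm_apply continuousOn_snd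
  have hopen : IsOpen (((chartAt H x₀).source ×ˢ (univ : Set (Fin N → (E →L[ℝ] E →L[ℝ] ℝ)))) ∩
      (fun p : M × (Fin N → (E →L[ℝ] E →L[ℝ] ℝ)) ↦ 𝒞.coeffCLM x₀ p.1 p.2) ⁻¹'
        {B : E →L[ℝ] E →L[ℝ] ℝ | ∀ v : E, v ≠ 0 → 0 < B v v}) :=
    hF.isOpen_inter_preimage ((chartAt H x₀).open_source.prod isOpen_univ) isOpen_setOf_posDef
  refine Filter.mem_of_superset (hopen.mem_nhds ⟨⟨hx₀, mem_univ _⟩, ?_⟩) ?_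
  · exact (𝒞.mem_posSet_iff_coeffCLM hx₀ w₀).1 hp
  · rintro ⟨x, w⟩ ⟨⟨hx, -⟩, hpos⟩
    exact (𝒞.mem_posSet_iff_coeffCLM hx w).2 hpos

/-- **Admissible maps**: `C^∞` maps `U : M → W` whose graph lies in the admissible set.
[folklore] -/
def Adm (U : M → Fin N → (E →L[ℝ] E →L[ℝ] ℝ)) : Prop :=
  ContMDiff I 𝓘(ℝ, Fin N → (E →L[ℝ] E →L[ℝ] ℝ)) ∞ U ∧ ∀ x, (x, U x) ∈ 𝒞.posSet

/-- **The assembled metric of an admissible map**: the `C^∞` Riemannian metric with values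
`𝒜 U` (symmetric by construction, positive definite by admissibility, smooth by
`contMDiff_assemble`). [folklore] -/
def metricOf (U : M → Fin N → (E →L[ℝ] E →L[ℝ] ℝ)) (hU : 𝒞.Adm U) :
    PseudoRiemannianMetric I ∞ E (TangentSpace I : M → Type _) where
  val := 𝒞.assemble U
  symm := 𝒞.assemble_symm U
  nondegenerate x v hv := by
    by_contra h0
    have h := hU.2 x v h0
    change 0 < 𝒞.assemble U x v v at h
    rw [hv v] at h
    exact lt_irrefl _ h
  contMDiff := 𝒞.contMDiff_assemble hU.1

omit [FiniteDimensional ℝ E] in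
/-- The assembled metric has values `𝒜 U`. [folklore] -/
@[simp]
theorem metricOf_val {U : M → Fin N → (E →L[ℝ] E →L[ℝ] ℝ)} (hU : 𝒞.Adm U) (x : M) :
    (𝒞.metricOf U hU).val x = 𝒞.assemble U x := rfl

omit [FiniteDimensional ℝ E] in
/-- The assembled metric of an admissible map is Riemannian. [folklore] -/
theorem isRiemannian_metricOf {U : M → Fin N → (E →L[ℝ] E →L[ℝ] ℝ)} (hU : 𝒞.Adm U) :
    (𝒞.metricOf U hU).IsRiemannian := fun x v hv ↦ hU.2 x v hv

variable [CompleteSpace E] {ι : Type*} [Fintype ι] [DecidableEq ι] (b : Module.Basis ι ℝ E)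
  (h : PseudoRiemannianMetric I ∞ E (TangentSpace I : M → Type _)) [h.HasLeviCivita]

open Classical in
/-- **The vector-valued Ricci–DeTurck system** `𝒫 U = 𝒟₀ U + ℰ(rdtForm (𝒜U) h) - ℰ(𝒜(𝒟₀ U))`
for admissible `U` (and the junk value `𝒟₀ U` otherwise), relative to the background metric `h`.
For a solution `U` of `∂ₜU = 𝒫 U` the assembled metrics `𝒜 U(t)` solve the Ricci–DeTurck
equation `∂ₜg = rdtForm g h` (`assembleAt_P`: `𝒜(𝒫 U) = rdtForm (𝒜 U) h`, because
`𝒜 ∘ ℰ = sym` and `rdtForm` is symmetric), while in every chart `𝒫` is quasilinear with the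
scalar principal symbol `|ξ|²_{𝒜U}` of `𝒟₀` (the principal parts of the two `ℰ`-terms cancel;
`RicciDeTurckSystemStructure.lean`). [cite: Topping2006, §5.2, Step 1] -/
def P (U : M → Fin N → (E →L[ℝ] E →L[ℝ] ℝ)) (x : M) : Fin N → (E →L[ℝ] E →L[ℝ] ℝ) :=
  𝒞.D0 b U x +
    (if hU : 𝒞.Adm U then
      haveI := (𝒞.metricOf U hU).hasLeviCivita
      𝒞.embed (rdtForm (𝒞.metricOf U hU) h) x - 𝒞.embed (𝒞.assemble (𝒞.D0 b U)) x
    else 0)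

/-- `𝒫` on admissible maps. [folklore] -/
theorem P_eq_of_adm {U : M → Fin N → (E →L[ℝ] E →L[ℝ] ℝ)} (hU : 𝒞.Adm U) (x : M) :
    𝒞.P b h U x = 𝒞.D0 b U x +
      haveI := (𝒞.metricOf U hU).hasLeviCivita
      (𝒞.embed (rdtForm (𝒞.metricOf U hU) h) x - 𝒞.embed (𝒞.assemble (𝒞.D0 b U)) x) := by
  rw [P, dif_pos hU]

omit [FiniteDimensional ℝ E] [CompleteSpace E] in
/-- The assembling map at a point is additive. [folklore] -/
theorem assembleAt_add (w w' : Fin N → (E →L[ℝ] E →L[ℝ] ℝ)) (x : M) :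
    𝒞.assembleAt (w + w') x = 𝒞.assembleAt w x + 𝒞.assembleAt w' x := by
  ext v v'
  rw [_root_.add_apply, _root_.add_apply, assembleAt_apply, assembleAt_apply, assembleAt_apply,
    ← Finset.sum_add_distrib]
  refine Finset.sum_congr rfl fun i _ ↦ ?_
  rw [Pi.add_apply, map_add, _root_.add_apply, _root_.add_apply, mul_add]

omit [FiniteDimensional ℝ E] [CompleteSpace E] in
/-- The assembling map at a point is odd. [folklore] -/
theorem assembleAt_sub (w w' : Fin N → (E →L[ℝ] E →L[ℝ] ℝ)) (x : M) :
    𝒞.assembleAt (w - w') x = 𝒞.assembleAt w x - 𝒞.assembleAt w' x := by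
  have h := 𝒞.assembleAt_add (w - w') w' x
  rw [sub_add_cancel] at h
  rw [h, add_sub_cancel_right]

/-- **The key algebraic identity of the reduction**: for admissible `U`,
`𝒜_x (𝒫 U x) = rdtForm (𝒜 U) h x` — the assembled time derivative of a solution of the
vector-valued system is the Ricci–DeTurck right-hand side of the assembled metric
(`𝒜(𝒟₀U) + sym (rdtForm) - sym (𝒜(𝒟₀U)) = rdtForm`, `assemble_embed`, `rdtForm_symm`).
[cite: Topping2006, §5.2, Step 1] -/
theorem assembleAt_P {U : M → Fin N → (E →L[ℝ] E →L[ℝ] ℝ)} (hU : 𝒞.Adm U) (x : M) :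
    𝒞.assembleAt (𝒞.P b h U x) x =
      haveI := (𝒞.metricOf U hU).hasLeviCivita
      rdtForm (𝒞.metricOf U hU) h x := by
  haveI := (𝒞.metricOf U hU).hasLeviCivita
  rw [𝒞.P_eq_of_adm b h hU, assembleAt_add, assembleAt_sub]
  have h1 : 𝒞.assembleAt (𝒞.embed (rdtForm (𝒞.metricOf U hU) h) x) x =
      rdtForm (𝒞.metricOf U hU) h x := by
    have h := 𝒞.assemble_embed_of_symm (s := rdtForm (𝒞.metricOf U hU) h)
      (fun x v v' ↦ rdtForm_symm _ h x v v')
    exact congrFun h x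
  have h2 : 𝒞.assembleAt (𝒞.embed (𝒞.assemble (𝒞.D0 b U)) x) x = 𝒞.assembleAt (𝒞.D0 b U x) x := by
    have h := 𝒞.assemble_embed_of_symm (s := 𝒞.assemble (𝒞.D0 b U)) (𝒞.assemble_symm _)
    exact congrFun h x
  rw [h1, h2]
  abel

end Operator

end ChartCover


end Literature.Geometry.Riemannian

end
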